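import Literature.AlgebraicTopology.SingularHomology.CohomologyHomotopyInvariance
import Mathlib.Topology.Homotopy.Contractible
import HarnessLib

/-!
# `U × C ≃ₕ U` for contractible `C`; `Hⁿ(U × C) ≅ Hⁿ(U)` by the projection and by any slice

A. Hatcher, *Algebraic Topology* (2002), §3.1 p. 201 (homotopy invariance of cohomology) with
Ch. 0 (a contractible space is homotopy equivalent to a point, hence `U × C ≃ U`): for a
contractible space `C` and any space `U`, the projection `pr₁ : U × C → U` is a homotopy
equivalence with homotopy inverse the slice `u ↦ (u, c)` through ANY point `c ∈ C`
(`prodFstHomotopyEquiv`), so `pr₁^* : Hⁿ(U; M) → Hⁿ(U × C; M)` is an isomorphism whose inverse is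
`s_c^*` for every `c` (`prodFstCohomologyIso`); in particular all slices induce the same map on
cohomology (`map_sliceAt_eq_map_sliceAt`). This is the input "`U × (chart) ≃ U`" of the
computation of `H^*(U × ℂ^×)` and `H^*(U × ℂP¹)` (the cohomology of a trivialised `ℂP¹`-bundle)
in the existence proof of Chern classes.

Everything is proved; no named facts. Mathlib: `ContractibleSpace`, `id_nullhomotopic` (used);
the tree: `singularCohomology.isoOfHomotopyEquiv'` (used). Nothing restated (searched `sliceAt`,
`HomotopyEquiv` + `Prod`, `ContractibleSpace` in the tree's SingularHomology files).

## References

* A. Hatcher, *Algebraic Topology*, CUP 2002, §3.1 p. 201; Ch. 0 p. 4 (contractible spaces).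
  [HatcherAT2002]
-/

noncomputable section

open CategoryTheory unitInterval

universe u v

namespace Literature.AlgebraicTopology.SingularHomology

variable {U : Type u} {C : Type u} [TopologicalSpace U] [TopologicalSpace C]

/-! ### Slices and the homotopy equivalence -/

/-- The slice `s_c : U → U × C`, `u ↦ (u, c)`. [folklore] -/
abbrev sliceAt (c : C) : C(U, U × C) := (ContinuousMap.id U).prodMk (ContinuousMap.const U c)

/-- `pr₁ ∘ s_c = 𝟙`. [folklore] -/
@[simp]
theorem fst_comp_sliceAt (c : C) :
    (ContinuousMap.fst : C(U × C, U)).comp (sliceAt c) = ContinuousMap.id U := by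
  ext u; rfl

/-- The homotopy `(t, (u, x)) ↦ (u, G(t, x))` from the identity of `U × C` to `s_{c₀} ∘ pr₁`, for a
contraction `G` of `C` to `c₀`. [folklore] -/
def prodContraction {c₀ : C} (G : (ContinuousMap.id C).Homotopy (ContinuousMap.const C c₀)) :
    (ContinuousMap.id (U × C)).Homotopy ((sliceAt c₀).comp (ContinuousMap.fst : C(U × C, U))) where
  toFun p := (p.2.1, G (p.1, p.2.2))
  continuous_toFun :=
    (continuous_fst.comp continuous_snd).prodMk
      (G.continuous.comp (continuous_fst.prodMk (continuous_snd.comp continuous_snd)))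
  map_zero_left p := by
    change (p.1, G (0, p.2)) = p
    rw [G.apply_zero]
    rfl
  map_one_left p := by
    change (p.1, G (1, p.2)) = (p.1, c₀)
    rw [G.apply_one]
    rfl

/-- The homotopy `(t, (u, x)) ↦ (u, γ t)` between the slices through the end points of a path. [folklore] -/
def sliceHomotopy {c₀ c : C} (γ : Path c₀ c) :
    ((sliceAt c₀).comp (ContinuousMap.fst : C(U × C, U))).Homotopy
      ((sliceAt c).comp (ContinuousMap.fst : C(U × C, U))) where
  toFun p := (p.2.1, γ p.1)
  continuous_toFun := (continuous_fst.comp continuous_snd).prodMk (γ.continuous.comp continuous_fst)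
  map_zero_left p := by
    change (p.1, γ 0) = (p.1, c₀)
    rw [γ.source]
  map_one_left p := by
    change (p.1, γ 1) = (p.1, c)
    rw [γ.target]

/-- **For contractible `C`, `s_c ∘ pr₁ ≃ 𝟙_{U × C}`** through ANY point `c` (contract the second
coordinate to the centre of a contraction, and join the centre to `c` by a path: contractible
spaces are path connected). [cite: HatcherAT2002, Ch. 0 p. 4] -/
theorem sliceAt_comp_fst_homotopic [ContractibleSpace C] (c : C) :
    ((sliceAt c).comp (ContinuousMap.fst : C(U × C, U))).Homotopic (ContinuousMap.id (U × C)) := by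
  obtain ⟨c₀, ⟨G⟩⟩ := id_nullhomotopic C
  haveI : PathConnectedSpace C := inferInstance
  let γ : Path c₀ c := (PathConnectedSpace.joined c₀ c).somePath
  have h₁ : (ContinuousMap.id (U × C)).Homotopic ((sliceAt c₀).comp (ContinuousMap.fst : C(U × C, U))) :=
    ⟨prodContraction (U := U) G⟩
  have h₂ : ((sliceAt c₀).comp (ContinuousMap.fst : C(U × C, U))).Homotopic
      ((sliceAt c).comp (ContinuousMap.fst : C(U × C, U))) := ⟨sliceHomotopy γ⟩
  exact (h₁.trans h₂).symm

/-- **`pr₁ : U × C → U` is a homotopy equivalence for contractible `C`**, with homotopy inverse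
the slice through `c` (`pr₁ ∘ s_c = 𝟙` exactly). [cite: HatcherAT2002, Ch. 0 p. 4] -/
def prodFstHomotopyEquiv [ContractibleSpace C] (c : C) : ContinuousMap.HomotopyEquiv (U × C) U where
  toFun := ContinuousMap.fst
  invFun := sliceAt c
  left_inv := sliceAt_comp_fst_homotopic c
  right_inv := by
    rw [fst_comp_sliceAt]

/-! ### Cohomology -/

variable (R : Type v) [CommRing R] (M : Type v) [AddCommGroup M] [Module R M]

/-- **`pr₁^* : Hⁿ(U; M) ≅ Hⁿ(U × C; M)` for contractible `C`**, with inverse `s_c^*` (homotopy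
invariance of cohomology, Hatcher 2002 §3.1 p. 201). [cite: HatcherAT2002, §3.1 p. 201] -/
def prodFstCohomologyIso [ContractibleSpace C] (c : C) (n : ℕ) :
    singularCohomology R M U n ≅ singularCohomology R M (U × C) n :=
  singularCohomology.isoOfHomotopyEquiv' R M (prodFstHomotopyEquiv c) n

/-- The isomorphism is `pr₁^*`. [folklore] -/
@[simp]
theorem prodFstCohomologyIso_hom [ContractibleSpace C] (c : C) (n : ℕ) :
    (prodFstCohomologyIso R M c n).hom =
      singularCohomology.map R M (ContinuousMap.fst : C(U × C, U)) n := rfl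

/-- Its inverse is `s_c^*`. [folklore] -/
@[simp]
theorem prodFstCohomologyIso_inv [ContractibleSpace C] (c : C) (n : ℕ) :
    (prodFstCohomologyIso R M (U := U) c n).inv = singularCohomology.map R M (sliceAt c) n := rfl

/-- `s_c^* ∘ pr₁^* = 𝟙` (no contractibility needed: `pr₁ ∘ s_c = 𝟙`). [folklore] -/
@[simp]
theorem map_sliceAt_map_fst (c : C) (n : ℕ) (y : singularCohomology R M U n) :
    singularCohomology.map R M (sliceAt c) n
        (singularCohomology.map R M (ContinuousMap.fst : C(U × C, U)) n y) = y := by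
  rw [← ModuleCat.comp_apply, ← singularCohomology.map_comp, fst_comp_sliceAt,
    singularCohomology.map_id]
  rfl

/-- `pr₁^* ∘ s_c^* = 𝟙` on `Hⁿ(U × C)` for contractible `C`. [cite: HatcherAT2002, §3.1 p. 201] -/
@[simp]
theorem map_fst_map_sliceAt [ContractibleSpace C] (c : C) (n : ℕ) (x : singularCohomology R M (U × C) n) :
    singularCohomology.map R M (ContinuousMap.fst : C(U × C, U)) n
        (singularCohomology.map R M (sliceAt c) n x) = x := by
  rw [← prodFstCohomologyIso_inv R M c n, ← prodFstCohomologyIso_hom R M c n, ← ModuleCat.comp_apply,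
    Iso.inv_hom_id, ModuleCat.id_apply]

/-- `pr₁^*` is bijective for contractible `C`. [cite: HatcherAT2002, §3.1 p. 201] -/
theorem map_fst_bijective [ContractibleSpace C] [Nonempty C] (n : ℕ) :
    Function.Bijective (singularCohomology.map R M (ContinuousMap.fst : C(U × C, U)) n) := by
  obtain ⟨c⟩ := ‹Nonempty C›
  exact (prodFstCohomologyIso R M (U := U) c n).toLinearEquiv.bijective

/-- `s_c^*` is bijective for contractible `C`. [cite: HatcherAT2002, §3.1 p. 201] -/
theorem map_sliceAt_bijective [ContractibleSpace C] (c : C) (n : ℕ) :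
    Function.Bijective (singularCohomology.map R M (sliceAt (U := U) c) n) :=
  (prodFstCohomologyIso R M (U := U) c n).symm.toLinearEquiv.bijective

/-- **All slices induce the same map on cohomology** (each is inverse to `pr₁^*`).
[cite: HatcherAT2002, §3.1 p. 201] -/
theorem map_sliceAt_eq_map_sliceAt [ContractibleSpace C] (c c' : C) (n : ℕ) :
    singularCohomology.map R M (sliceAt (U := U) c) n = singularCohomology.map R M (sliceAt c') n := by
  rw [← prodFstCohomologyIso_inv R M c n, ← prodFstCohomologyIso_inv R M c' n]
  congr 1
  exact Iso.ext rfl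

/-- Every class on `U × C` is pulled back from `U`: `x = pr₁^*(s_c^* x)`. [cite: HatcherAT2002, §3.1 p. 201] -/
theorem eq_map_fst_map_sliceAt [ContractibleSpace C] (c : C) (n : ℕ) (x : singularCohomology R M (U × C) n) :
    x = singularCohomology.map R M (ContinuousMap.fst : C(U × C, U)) n
      (singularCohomology.map R M (sliceAt c) n x) :=
  (map_fst_map_sliceAt R M c n x).symm

end Literature.AlgebraicTopology.SingularHomology
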